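import Literature.NumberTheory.Automorphic.QuaternionLocalSplitTraceAdjust
import Literature.NumberTheory.Automorphic.AdicCompletionUnitNorms
import Literature.NumberTheory.Automorphic.AdicCompletionCompact
import HarnessLib

/-!
# Good places: a norm-one quaternion with integral trace is conjugate into the standard order

Topic `NumberTheory/Automorphic`; theorems only (no definition, no named fact). A local input of
Kneser's strong approximation theorem for `ℍ[K,a,b]¹` (Vignéras, LNM 800, Ch. III §4, proof of
Thm. 4.3) at the places `v` *away* from the finite set where closeness is demanded: there the
global element of norm `1` and `v`-integral trace must only be moved into the local order
`O_v = 𝒪_v⟨1, i, j, k⟩`. At a place `v ∤ 2αβ` (`|α| = |β| = |2| = 1`):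

* `exists_integer_sq_sub_mul_sq` : `β = s² - α t²` has a solution with `s, t ∈ 𝒪_v` (Hensel,
  `exists_sq_sub_mul_sq_of_isUnit` of `AdicCompletionUnitNorms` in the Henselian ring `𝒪_v` with
  finite residue field; Vignéras II §1 Lemme 1.10), so the splitting
  `ψ : ℍ[K_v,α,β] ≃ M₂(K_v)` of `QuaternionSplitMatrixModel` has `ψ⁻¹(M₂(𝒪_v)) ⊆ O_v`
  (`valued_splitSection_le_one`);
* `exists_units_conj_integral` : **every `y ∈ ℍ[K_v,α,β]` with `y ȳ = 1` and `|2 y₀| ≤ 1` is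
  conjugate under `ℍ[K_v,α,β]^×` to an element of `O_v`** (all four coordinates of valuation
  `≤ 1`): `ψ(y) ∈ SL₂(K_v)` has integral characteristic polynomial `X² - 2y₀ X + 1`, hence is
  `±1` or conjugate to its companion matrix `[0, -1; 1, 2y₀] ∈ M₂(𝒪_v)` (rational canonical
  form, `MatrixTwoConjugacy.exists_conj_eq_companion`); Vignéras II §2: an integral element lies
  in a maximal order, and the maximal orders of `M(2, K_v)` are the conjugates of `M(2, R_v)`.

## References

* M.-F. Vignéras, *Arithmétique des algèbres de quaternions*, LNM 800 (1980), Ch. II §1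
  Lemme 1.10, §2 (ordres maximaux de `M(2,K)`), Ch. III §4 (proof of Thm. 4.3) [VignerasLNM800].
-/

noncomputable section

open scoped Quaternion WithZero Valued
open NumberField IsDedekindDomain

namespace Literature.NumberTheory.Automorphic

namespace QuaternionAlgebra

variable (K : Type) [Field K] [NumberField K] (v : HeightOneSpectrum (𝓞 K))

/-- `K_v`. -/
local notation "Kᵥ" => HeightOneSpectrum.adicCompletion K v

/-- **`β = s² - α t²` with `s, t ∈ 𝒪_v`** when `|α| = |β| = |2| = 1` (Hensel's lemma in `𝒪_v`,
`exists_sq_sub_mul_sq_of_isUnit`; Vignéras II §1 Lemme 1.10: `(α, β)_v = 1` for units at a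
non-dyadic place). [cite: VignerasLNM800, Ch. II §1 Lemme 1.10] -/
theorem exists_integer_sq_sub_mul_sq {α β : Kᵥ} (hα : Valued.v α = 1) (hβ : Valued.v β = 1)
    (h2 : Valued.v (2 : Kᵥ) = 1) :
    ∃ s t : Kᵥ, Valued.v s ≤ 1 ∧ Valued.v t ≤ 1 ∧ s ^ 2 - α * t ^ 2 = β := by
  haveI : HenselianLocalRing 𝒪[Kᵥ] := inferInstanceAs (HenselianLocalRing (v.adicCompletionIntegers K))
  haveI : Finite 𝓀[Kᵥ] := finite_residueField_adicCompletion K v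
  have hint : (Valued.v (R := Kᵥ)).Integers 𝒪[Kᵥ] := Valuation.integer.integers _
  have hunit : ∀ {c : Kᵥ} (hc : Valued.v c = 1),
      IsUnit (⟨c, by rw [Valuation.mem_integer_iff, hc]⟩ : 𝒪[Kᵥ]) :=
    fun {c} hc => hint.isUnit_iff_valuation_eq_one.mpr hc
  have h2' : IsUnit (2 : 𝒪[Kᵥ]) := by
    convert hunit h2 using 1
    refine Subtype.ext ?_
    norm_cast
  obtain ⟨s, t, hst⟩ := exists_sq_sub_mul_sq_of_isUnit h2' (hunit hα) (hunit hβ)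
  refine ⟨s, t, (Valuation.mem_integer_iff _ _).mp s.2, (Valuation.mem_integer_iff _ _).mp t.2, ?_⟩
  simpa using congrArg Subtype.val hst

/-- With `s, t, α, β ∈ 𝒪_v` and `|2αβ| = 1`, **`ψ⁻¹` maps `M₂(𝒪_v)` into `O_v`**: the coordinates
of `splitSection m` are `(2αβ)⁻¹` times `𝒪_v`-linear combinations of the entries of `m`.
[folklore] -/
theorem valued_splitSection_le_one {α β s t : Kᵥ} (hα : Valued.v α ≤ 1) (hβ : Valued.v β ≤ 1)
    (hs : Valued.v s ≤ 1) (ht : Valued.v t ≤ 1) (hδ : IsUnit (2 * α * β))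
    (hu : Valued.v (((hδ.unit⁻¹ : Kᵥˣ) : Kᵥ)) ≤ 1)
    (m : Matrix (Fin 2) (Fin 2) Kᵥ) (hm : ∀ i j, Valued.v (m i j) ≤ 1) :
    Valued.v (splitSection s t hδ m).re ≤ 1 ∧ Valued.v (splitSection s t hδ m).imI ≤ 1 ∧
    Valued.v (splitSection s t hδ m).imJ ≤ 1 ∧ Valued.v (splitSection s t hδ m).imK ≤ 1 := by
  have h00 := hm 0 0; have h01 := hm 0 1; have h10 := hm 1 0; have h11 := hm 1 1
  -- products of integral elements are integral
  have hmul : ∀ {x y : Kᵥ}, Valued.v x ≤ 1 → Valued.v y ≤ 1 → Valued.v (x * y) ≤ 1 :=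
    fun hx hy => by rw [map_mul]; exact mul_le_one' hx hy
  have hadd : ∀ {x y : Kᵥ}, Valued.v x ≤ 1 → Valued.v y ≤ 1 → Valued.v (x + y) ≤ 1 :=
    fun hx hy => Valuation.map_add_le _ hx hy
  have hsub : ∀ {x y : Kᵥ}, Valued.v x ≤ 1 → Valued.v y ≤ 1 → Valued.v (x - y) ≤ 1 :=
    fun hx hy => Valuation.map_sub_le _ hx hy
  refine ⟨?_, ?_, ?_, ?_⟩
  · rw [splitSection_re]
    exact hmul hu (hmul (hmul hα hβ) (hadd h00 h11))
  · rw [splitSection_imI]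
    exact hmul hu (hmul hβ (hadd h01 (hmul hα h10)))
  · rw [splitSection_imJ]
    exact hmul hu (hmul hα (hsub (hmul hs (hsub h00 h11)) (hmul ht (hsub (hmul hα h10) h01))))
  · rw [splitSection_imK]
    exact hmul hu (hsub (hmul hs (hsub (hmul hα h10) h01)) (hmul (hmul hα ht) (hsub h00 h11)))

/-- **Good places: a norm-one quaternion with integral trace is conjugate into `O_v`.** Let
`|α| = |β| = |2| = 1` in `K_v` and `y ∈ ℍ[K_v,α,β]` with `y ȳ = 1` and `|2 y₀| ≤ 1`. Then some
unit `x` of `ℍ[K_v,α,β]` has `x y x⁻¹ ∈ O_v = 𝒪_v⟨1,i,j,k⟩`, i.e. all four coordinates of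
`x y x⁻¹` have valuation `≤ 1` (`ψ(y)` is `±1` or conjugate to the companion matrix
`[0, -1; 1, 2y₀] ∈ M₂(𝒪_v)`; Vignéras II §2, III §4). [cite: VignerasLNM800, Ch. II §2 and Ch. III §4 (proof of Thm. 4.3)] -/
theorem exists_units_conj_integral {α β : Kᵥ} (hα : Valued.v α = 1) (hβ : Valued.v β = 1)
    (h2 : Valued.v (2 : Kᵥ) = 1) (y : ℍ[Kᵥ,α,β]) (hy : y * star y = 1)
    (htr : Valued.v (2 * y.re) ≤ 1) :
    ∃ x : (ℍ[Kᵥ,α,β])ˣ,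
      Valued.v ((x : ℍ[Kᵥ,α,β]) * y * ((x⁻¹ : (ℍ[Kᵥ,α,β])ˣ) : ℍ[Kᵥ,α,β])).re ≤ 1 ∧
      Valued.v ((x : ℍ[Kᵥ,α,β]) * y * ((x⁻¹ : (ℍ[Kᵥ,α,β])ˣ) : ℍ[Kᵥ,α,β])).imI ≤ 1 ∧
      Valued.v ((x : ℍ[Kᵥ,α,β]) * y * ((x⁻¹ : (ℍ[Kᵥ,α,β])ˣ) : ℍ[Kᵥ,α,β])).imJ ≤ 1 ∧
      Valued.v ((x : ℍ[Kᵥ,α,β]) * y * ((x⁻¹ : (ℍ[Kᵥ,α,β])ˣ) : ℍ[Kᵥ,α,β])).imK ≤ 1 := by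
  -- an integral splitting
  obtain ⟨s, t, hs, ht, hst⟩ := exists_integer_sq_sub_mul_sq K v hα hβ h2
  have hα0 : α ≠ 0 := (Valuation.ne_zero_iff _).mp (by rw [hα]; exact one_ne_zero)
  have hβ0 : β ≠ 0 := (Valuation.ne_zero_iff _).mp (by rw [hβ]; exact one_ne_zero)
  have h20 : (2 : Kᵥ) ≠ 0 := (Valuation.ne_zero_iff _).mp (by rw [h2]; exact one_ne_zero)
  have hδ : IsUnit (2 * α * β) := isUnit_iff_ne_zero.mpr (mul_ne_zero (mul_ne_zero h20 hα0) hβ0)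
  have hu : Valued.v (((hδ.unit⁻¹ : Kᵥˣ) : Kᵥ)) ≤ 1 := by
    have h : Valued.v (((hδ.unit⁻¹ : Kᵥˣ) : Kᵥ)) = 1 := by
      rw [Units.val_inv_eq_inv_val, map_inv₀, IsUnit.unit_spec, map_mul, map_mul, h2, hα, hβ,
        one_mul, one_mul, inv_one]
    exact h.le
  set ψ := splitEquiv hst hδ with hψ
  set M := splitHom α β s t hst y with hM
  have hdet : M.det = 1 := by rw [hM, det_splitHom, ← mul_star_eq_one_iff_coords]; exact hy
  have htrM : M.trace = 2 * y.re := trace_splitHom hst y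
  have hyψ : y = ψ.symm M := by
    rw [hM, ← splitEquiv_apply hst hδ, ← hψ, AlgEquiv.symm_apply_apply]
  by_cases hbot : M ∈ (⊥ : Subalgebra Kᵥ (Matrix (Fin 2) (Fin 2) Kᵥ))
  · -- `M = c • 1`, so `y = c` with `c² = 1`: already in `O_v`
    rw [Algebra.mem_bot, Set.mem_range] at hbot
    obtain ⟨c, hc⟩ := hbot
    have hyc : y = algebraMap Kᵥ ℍ[Kᵥ,α,β] c := by rw [hyψ, ← hc, AlgEquiv.commutes]
    have hc2 : c ^ 2 = 1 := by
      rw [← hc, Matrix.algebraMap_eq_diagonal, Matrix.det_diagonal, Fin.prod_univ_two,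
        Pi.algebraMap_apply, Pi.algebraMap_apply, Algebra.algebraMap_self_apply] at hdet
      rw [pow_two]; exact hdet
    have hvc : Valued.v c ≤ 1 := by
      have h : Valued.v c ^ 2 = 1 := by rw [← map_pow, hc2, map_one]
      exact (pow_le_one_iff two_ne_zero).mp h.le
    refine ⟨1, ?_⟩
    simp only [Units.val_one, inv_one, one_mul, mul_one, hyc,
      _root_.QuaternionAlgebra.algebraMap_eq]
    refine ⟨hvc, ?_, ?_, ?_⟩ <;> simp
  · -- rational canonical form: `P⁻¹ M P = [0, -1; 1, 2y₀]`
    obtain ⟨P, hP, -, hPMP⟩ := exists_conj_eq_companion hbot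
    set Pu : (Matrix (Fin 2) (Fin 2) Kᵥ)ˣ := Matrix.nonsingInvUnit P (isUnit_iff_ne_zero.mpr hP)
      with hPu
    have hPu1 : ((Pu⁻¹ : (Matrix (Fin 2) (Fin 2) Kᵥ)ˣ) : Matrix (Fin 2) (Fin 2) Kᵥ) = P⁻¹ := by
      rw [Matrix.coe_units_inv, hPu]
      rfl
    have hPu2 : ((Pu : (Matrix (Fin 2) (Fin 2) Kᵥ)ˣ) : Matrix (Fin 2) (Fin 2) Kᵥ) = P := rfl
    set x : (ℍ[Kᵥ,α,β])ˣ :=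
      Units.map (ψ.symm : Matrix (Fin 2) (Fin 2) Kᵥ ≃ₐ[Kᵥ] ℍ[Kᵥ,α,β]).toMonoidHom Pu⁻¹ with hx
    refine ⟨x, ?_⟩
    have hx1 : (x : ℍ[Kᵥ,α,β]) = ψ.symm P⁻¹ := by rw [← hPu1]; rfl
    have hx2 : ((x⁻¹ : (ℍ[Kᵥ,α,β])ˣ) : ℍ[Kᵥ,α,β]) = ψ.symm P := by
      rw [hx, ← map_inv, inv_inv]
      rfl
    have hconj' : (x : ℍ[Kᵥ,α,β]) * y * ((x⁻¹ : (ℍ[Kᵥ,α,β])ˣ) : ℍ[Kᵥ,α,β]) =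
        ψ.symm (P⁻¹ * M * P) := by
      rw [hx1, hx2]
      conv_lhs => rw [hyψ]
      rw [← map_mul, ← map_mul]
    have hconj : (x : ℍ[Kᵥ,α,β]) * y * ((x⁻¹ : (ℍ[Kᵥ,α,β])ˣ) : ℍ[Kᵥ,α,β]) =
        splitSection s t hδ !![0, -1; 1, 2 * y.re] := by
      rw [hconj', hPMP, hdet, htrM, hψ, splitEquiv_symm_apply]
    rw [hconj]
    refine valued_splitSection_le_one K v hα.le hβ.le hs ht hδ hu _ fun i j => ?_
    fin_cases i <;> fin_cases j
    · simp
    · simp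
    · simp
    · simpa using htr

end QuaternionAlgebra

end Literature.NumberTheory.Automorphic
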